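import Mathlib
import Summits.ValiantsHypothesis.ValiantsHypothesis.Theorems.RigidityForcesSymmetryRankRigidMinimalReprLaplaceFiveSectorSplitDefs
import Summits.ValiantsHypothesis.ValiantsHypothesis.Theorems.RigidityForcesSymmetryRankRigidMinimalReprLaplaceFiveSymmetricPieces
import Summits.ValiantsHypothesis.ValiantsHypothesis.Theorems.RigidityForcesSymmetryRankRigidMinimalReprLaplaceFiveTriangleNoSideSym
import Summits.ValiantsHypothesis.ValiantsHypothesis.Theorems.RigidityForcesSymmetryRankRigidMinimalReprLaplaceFiveFourSplit

/-!
# ValiantsHypothesis / RigidityForcesSymmetry — crux `LaplaceOptimalFive` (stmt-ValiantsHypothesis-24813), crux idea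
`young-shadow` (K1): **PROP A AT FOUR SPLITS, RIGID SUPPORTS** — a side-symmetric pair decomposition of `P₅` supported on exactly
four distinct pair splits forming a path `P₅`, a paw or a chair (not a star, no isolated split, not a 4-cycle) weighs `≥ 120`.

Assembly of ✓ `LaplaceFiveFourSplit.fourSplit_separation_rigid` (every Young shadow fully symmetric) and the catalecticant step
✓ `symmetricPieces_needTen`.  With ✓ `LaplaceFivePropA.sideSym_threePairSplits` (≤ 3 splits) this is K1 on EVERY RIGID support
(all supports with ≥ 5 pair splits, and `K₁,₄`, `C₄`, `K₃ ⊔ K₂`, are slack).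

Honest framing.  K1 `SideSymLaplaceOptimalFive` on slack supports, S2′/S3′, `LaplaceOptimalFive` (OPEN · CONTESTED 72/120),
`RankRigidMinimalRepr`, `VP ≠ VNP` are NOT proved.  No definitions, no `sorry`; Mathlib + tree only.
-/

set_option linter.dupNamespace false

namespace Summit.ValiantsHypothesis.ValiantsHypothesis.Theorems.RigidityForcesSymmetryRankRigidMinimalRepr

namespace LaplaceFivePropA

open Finset LaplaceFiveSectorSplit

/-- **PROP A at four splits, rigid supports.** [folklore] -/
theorem sideSym_fourPairSplits_rigid (N : ℕ) (T : Finset (Fin N)) (S : Fin N → Finset (Fin 5))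
    (u w : Fin N → (Fin 5 → Fin 5) → ℂ) (hdec : IsSplitDecomposition T S u w) (hsym : SideSymmetric T S u w)
    (hpair : ∀ t ∈ T, (S t).card = 2) (h4 : (T.image S).card = 4)
    (hstar : ¬ ∃ c : Fin 5, ∀ A ∈ T.image S, c ∈ A)
    (hiso : ¬ ∃ A ∈ T.image S, ∀ B ∈ T.image S, B ≠ A → Disjoint A B)
    (hcyc : ¬ ∀ x : Fin 5, ((T.image S).filter (fun A => x ∈ A)).card = 0 ∨ ((T.image S).filter (fun A => x ∈ A)).card = 2) :
    Nat.factorial 5 ≤ laplaceWeight T S := by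
  classical
  obtain ⟨hu, hw, hid⟩ := hdec
  have hside : ∀ A : Finset (Fin 5),
      SlotInvariantOn A (fun v => ∑ t ∈ T.filter (fun t => S t = A), u t v * w t v)
        ∧ SlotInvariantOn Aᶜ (fun v => ∑ t ∈ T.filter (fun t => S t = A), u t v * w t v) := fun A =>
    ⟨fun τ hτ v => LaplaceFiveTriangleSeparation.shadow_inv_left T S u w hw hsym A τ hτ v,
      fun τ hτ v => LaplaceFiveTriangleSeparation.shadow_inv_right T S u w hu hsym A τ hτ v⟩
  have hfib : ∀ v : Fin 5 → Fin 5, ∑ A ∈ T.image S, ∑ t ∈ T.filter (fun t => S t = A), u t v * w t v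
      = if Function.Injective v then 1 else 0 := by
    intro v
    rw [Finset.sum_fiberwise_of_maps_to (g := S) (fun t (ht : t ∈ T) => Finset.mem_image_of_mem S ht)]
    exact hid v
  have hsum : SlotInvariantOn Finset.univ
      (∑ A ∈ T.image S, (fun v => ∑ t ∈ T.filter (fun t => S t = A), u t v * w t v)) := by
    intro τ _ v
    rw [Finset.sum_apply, Finset.sum_apply, hfib, hfib, if_congr (Equiv.injective_comp τ v) rfl rfl]
  have hon := LaplaceFiveFourSplit.fourSplit_separation_rigid (T.image S) h4
    (fun A hA => by obtain ⟨t, ht, rfl⟩ := Finset.mem_image.mp hA; exact hpair t ht)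
    hstar hiso hcyc (fun A => fun v => ∑ t ∈ T.filter (fun t => S t = A), u t v * w t v) (fun A _ => hside A) hsum
  have hsymm : ∀ A : Finset (Fin 5),
      SlotInvariantOn Finset.univ (fun v => ∑ t ∈ T.filter (fun t => S t = A), u t v * w t v) := by
    intro A
    by_cases hA : A ∈ T.image S
    · exact hon A hA
    · have hempty : T.filter (fun t => S t = A) = ∅ := by
        refine Finset.filter_eq_empty_iff.mpr fun t ht h => hA ?_
        rw [← h]; exact Finset.mem_image_of_mem S ht
      intro τ _ v
      simp only [hempty, Finset.sum_empty]
  have hten := LaplaceFiveSymmetricPieces.symmetricPieces_needTen N T S u w ⟨hu, hw, hid⟩ hpair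
    (fun A τ hτ v => hsymm A τ hτ v)
  have hwt : laplaceWeight T S = ∑ t ∈ T, 12 := by
    refine Finset.sum_congr rfl fun t ht => ?_
    rw [hpair t ht]; decide
  rw [hwt, Finset.sum_const, smul_eq_mul]
  show 120 ≤ T.card * 12
  omega

end LaplaceFivePropA

end Summit.ValiantsHypothesis.ValiantsHypothesis.Theorems.RigidityForcesSymmetryRankRigidMinimalRepr
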